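import Literature.NumberTheory.EllipticCurves.GeomPointReduction
import Literature.NumberTheory.EllipticCurves.ReductionHomomorphismSurjectiveProofs
import Literature.NumberTheory.EllipticCurves.FormalGroupDivision
import Literature.NumberTheory.EllipticCurves.LocalPointsIntegersSubgroup
import Literature.NumberTheory.GaloisRepresentations.InertiaRootsOfUnity
import Mathlib.RingTheory.Henselian
import HarnessLib

/-!
# Kramer 1981 §2 Prop. 3 — the kernel of reduction is `2`-divisible and
# `#E(F)/2E(F) = #Ẽ(k)[2]` over a local field of odd residue characteristic

Second proof file towards the discharge of the named fact
`Literature.NumberTheory.EllipticCurves.Kramer1981.prop3_ramifiedOddGoodNormIndex`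
(K. Kramer, *Arithmetic of elliptic curves upon quadratic extension*, Trans. AMS 264 (1981), §2
Prop. 3, p. 125). Kramer's proof reads: "Let `E₁` denote the kernel of reduction … Since `E₁(F)` is
uniquely divisible by `2` via [15, p. 189] … `i(K/F) = dim E(k)/2E(k) = dim E(k)₂`" ([15] = Tate,
*The arithmetic of elliptic curves*, Invent. Math. 23 (1974)). This file proves, for a
non-archimedean local field `F` (Mathlib `IsNonarchimedeanLocalField`) of ODD residue characteristic
and a Weierstrass equation `W` over `𝒪[F]` with unit discriminant (good reduction), in the
vocabulary of the tree's reduction homomorphism (`ReductionHomomorphism.lean`,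
`GeomPointReduction.lean`:
`WeierstrassCurve.reducePoint`, `WeierstrassCurve.ReducesToZero`, `goodReductionHom`):

* `exists_two_nsmul_eq_of_reducesToZero` — **`E₁(F) ⊆ 2 E₁(F)`**: every point of the kernel of
  reduction is twice a point of the kernel of reduction (Silverman, *AEC* IV.2.3(b)/IV.3.2/VII.2.2:
  `[2] : Ê(𝓜) ⥲ Ê(𝓜)` for `2 ∈ R^*`), obtained from the tree's chart-theoretic division theorem
  `FormalGroupChart.map_nsmul_kernelLevel_eq` (`FormalGroupDivision.lean`), whose analytic inputs —
  completeness of `F` for the real valuation `‖·‖` extending `v_F` (`exists_limit_of_geometric`)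
  and Hensel's lemma in `𝒪[F]` (`exists_mem_kernel_zCoord_eq`: every small parameter is `z(P)`) —
  are discharged here for an abstract local field exactly as the tree does for the completions of a
  number field (`LocalPointsIntegersSubgroup.lean`);
* `range_two_eq_comap_range_two` and **`index_range_two_eq_card_torsionBy_two`** —
  `[E(F) : 2E(F)] = #Ẽ(k)[2]`: reduction `E(F) → Ẽ(k)` is onto (henselian `𝒪[F]`, tree
  `exists_reducePoint_eq`) with kernel `E₁(F) ⊆ 2E(F)`, so `E(F)/2E(F) ≅ Ẽ(k)/2Ẽ(k)`, of order
  `#Ẽ(k)[2]` (`Ẽ(k)` finite).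

Theorems only (no definition, no named fact); the real valuation `w` is produced existentially
(`exists_valuation_eq_algNorm`) and threaded as a hypothesis.

## References

* [Kramer1981] K. Kramer, Trans. AMS 264 (1981), §2 Prop. 3 and its proof (p. 125).
* [SilvermanAEC2009] J. H. Silverman, *The Arithmetic of Elliptic Curves*, 2nd ed. (2009),
  Prop. IV.2.3, IV.3.2, Thm. IV.6.4, Prop. VII.2.1, VII.2.2, VII.3.1.
* [MilneADT2006] J. S. Milne, *Arithmetic Duality Theorems*, I Lemma 3.3 (the count
  `[A : nA]/#A[n]`).
-/

noncomputable section

open scoped Classical NNReal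
open ValuativeRel Field Polynomial Filter Topology
open Literature.NumberTheory.GaloisRepresentations
open Literature.NumberTheory.GaloisRepresentations.IsNonarchimedeanLocalField
open Literature.NumberTheory.EllipticCurves.FormalGroupChart
open _root_.WeierstrassCurve

namespace Literature.NumberTheory.EllipticCurves.Kramer1981

variable {F : Type*} [Field F] [ValuativeRel F] [TopologicalSpace F] [IsNonarchimedeanLocalField F]

/-! ## §0 Private local-field plumbing -/

/-- Hensel's lemma in `𝒪[F]` (Mathlib `IsAdicComplete 𝓂[F] 𝒪[F]`). [folklore] -/
private theorem henselianLocalRing_integer' : HenselianLocalRing 𝒪[F] := by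
  letI := IsTopologicalAddGroup.rightUniformSpace F
  haveI := isUniformAddGroup_of_addCommGroup (G := F)
  exact
    { is_henselian := fun f hf a₀ h₁ h₂ =>
        HenselianRing.is_henselian (I := 𝓂[F]) f hf a₀ h₁ (h₂.map _) }

omit [TopologicalSpace F] [IsNonarchimedeanLocalField F] in
/-- Units of `𝒪[F]` are the elements of valuation `1`. [folklore] -/
private theorem isUnit_integer_iff' {a : 𝒪[F]} : IsUnit a ↔ valuation F (a : F) = 1 :=
  (Valuation.integer.integers (valuation F)).isUnit_iff_valuation_eq_one

/-- `𝓂[F]` is the set of elements of valuation `< 1`. [folklore] -/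
private theorem mem_maximalIdeal_iff' {a : 𝒪[F]} : a ∈ 𝓂[F] ↔ valuation F (a : F) < 1 := by
  rw [IsLocalRing.mem_maximalIdeal, mem_nonunits_iff,
    Valuation.Integer.not_isUnit_iff_valuation_lt_one]

/-- `2 ∈ 𝒪[F]ˣ` in odd residue characteristic. [folklore] -/
private theorem isUnit_two' (hodd : ringChar 𝓀[F] ≠ 2) : IsUnit (2 : 𝒪[F]) := by
  rw [← IsLocalRing.residue_ne_zero_iff_isUnit, map_ofNat]
  intro h2
  have hdvd : ringChar 𝓀[F] ∣ 2 := by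
    rw [← ringChar.spec 𝓀[F] 2]; exact_mod_cast h2
  rcases (Nat.dvd_prime Nat.prime_two).mp hdvd with h | h
  · exact CharP.ringChar_ne_one (R := 𝓀[F]) h
  · exact hodd h

/-! ## §1 The real valuation of `F` and its dictionary with `𝒪[F]` -/

variable (F) in
/-- **The real-valued absolute value of `F`** as a `Valuation F ℝ≥0`: there is `w` with
`w a = ‖a‖` (the tree's `algNorm F` on `F ⊆ F̄`, i.e. Mathlib's `NormedField.valuation` for the
normed structure `nontriviallyNormedField F` of the valuation). Produced existentially; no
definition.
Neukirch, *ANT*, II (3.7)–(4.8). [cite: NeukirchANT1999, Ch. II (4.8)] -/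
theorem exists_valuation_eq_algNorm :
    ∃ w : Valuation F ℝ≥0,
      ∀ a : F, (w a : ℝ) = algNorm F (algebraMap F (AlgebraicClosure F) a) := by
  letI := nontriviallyNormedField F
  refine ⟨NormedField.valuation, fun a => ?_⟩
  rw [NormedField.valuation_apply, coe_nnnorm, algNorm_algebraMap]

section RealValuation

variable {w : Valuation F ℝ≥0}
  (hw : ∀ a : F, (w a : ℝ) = algNorm F (algebraMap F (AlgebraicClosure F) a))
include hw

/-- `w a ≤ 1 ↔ a ∈ 𝒪[F]`. [folklore] -/
private theorem w_le_one_iff (a : F) : w a ≤ 1 ↔ a ∈ 𝒪[F] := by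
  rw [← NNReal.coe_le_coe, hw, NNReal.coe_one]
  exact algNorm_algebraMap_le_one_iff

/-- `w a < 1 ↔ v(a) < 1`. [folklore] -/
private theorem w_lt_one_iff (a : F) : w a < 1 ↔ valuation F a < 1 := by
  rw [← NNReal.coe_lt_coe, hw, NNReal.coe_one]
  exact algNorm_algebraMap_lt_one_iff

/-- `1 < w a ↔ 1 < v(a)`. [folklore] -/
private theorem one_lt_w_iff (a : F) : 1 < w a ↔ 1 < valuation F a := by
  rw [← not_le, w_le_one_iff hw, ← not_le]
  exact Iff.rfl

/-- For `a ∈ 𝒪[F]`: `w a < 1 ↔ a ∈ 𝓂[F]`. [folklore] -/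
private theorem w_coe_lt_one_iff (a : 𝒪[F]) : w (a : F) < 1 ↔ a ∈ 𝓂[F] := by
  rw [w_lt_one_iff hw, mem_maximalIdeal_iff']

/-- For `a ∈ 𝒪[F]`: `w a = 1 ↔ a` is a unit. [folklore] -/
private theorem w_coe_eq_one_iff (a : 𝒪[F]) : w (a : F) = 1 ↔ IsUnit a := by
  rw [isUnit_integer_iff']
  have h1 : w (a : F) ≤ 1 := (w_le_one_iff hw _).mpr a.2
  have h2 : valuation F (a : F) ≤ 1 := a.2
  have h3 : w (a : F) < 1 ↔ valuation F (a : F) < 1 := w_lt_one_iff hw (a : F)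
  constructor
  · intro h
    by_contra hne
    have := h3.mpr (lt_of_le_of_ne h2 hne)
    rw [h] at this
    exact lt_irrefl _ this
  · intro h
    by_contra hne
    have := h3.mp (lt_of_le_of_ne h1 hne)
    rw [h] at this
    exact lt_irrefl _ this

/-- `w 2 = 1` in odd residue characteristic. [folklore] -/
private theorem w_two (hodd : ringChar 𝓀[F] ≠ 2) : w (2 : F) = 1 := by
  have h := (w_coe_eq_one_iff hw (2 : 𝒪[F])).mpr (isUnit_two' hodd)
  have e : ((2 : 𝒪[F]) : F) = 2 := map_ofNat (algebraMap 𝒪[F] F) 2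
  rw [e] at h
  exact h

/-- For a Weierstrass equation `W` over `𝒪[F]`, `W ⊗ F` is integral for `w`. [folklore] -/
private theorem isIntegral_baseChange (W : WeierstrassCurve 𝒪[F]) :
    (W.baseChange F).IsIntegral w.integer := by
  refine isIntegral_of_exists_lift _ ?_ ?_ ?_ ?_ ?_
  · exact ⟨⟨(W.a₁ : F), (w_le_one_iff hw _).mpr W.a₁.2⟩, rfl⟩
  · exact ⟨⟨(W.a₂ : F), (w_le_one_iff hw _).mpr W.a₂.2⟩, rfl⟩
  · exact ⟨⟨(W.a₃ : F), (w_le_one_iff hw _).mpr W.a₃.2⟩, rfl⟩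
  · exact ⟨⟨(W.a₄ : F), (w_le_one_iff hw _).mpr W.a₄.2⟩, rfl⟩
  · exact ⟨⟨(W.a₆ : F), (w_le_one_iff hw _).mpr W.a₆.2⟩, rfl⟩

/-- **`F` is complete for `w`: geometric Cauchy sequences converge with the expected error** —
the hypothesis `hcomplete` of `FormalGroupChart.map_nsmul_kernelLevel_eq` (Mathlib's
`CompleteSpace F` for a local field; the tree's `LocalPoints.exists_limit_of_geometric` verbatim
for an abstract `F`). [cite: SerreLocalFields1979, Ch. II §1 (a local field is complete)] -/
theorem exists_limit_of_geometric (x : ℕ → F) (C θ : ℝ≥0) (hθ : θ < 1)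
    (hx : ∀ k, w (x (k + 1) - x k) ≤ C * θ ^ k) : ∃ y : F, ∀ k, w (y - x k) ≤ C * θ ^ k := by
  letI := nontriviallyNormedField F
  have hwn : ∀ a : F, w a = ‖a‖₊ := fun a => by
    apply NNReal.coe_injective
    rw [hw, coe_nnnorm, algNorm_algebraMap]
  simp only [hwn] at hx ⊢
  have htail : ∀ k m, ‖x (k + m) - x k‖₊ ≤ C * θ ^ k := by
    intro k m
    induction m with
    | zero => simp
    | succ m ih =>
      have e : x (k + (m + 1)) - x k = (x (k + m + 1) - x (k + m)) + (x (k + m) - x k) := by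
        rw [← add_assoc]; abel
      rw [e]
      refine (IsUltrametricDist.nnnorm_add_le_max _ _).trans (max_le ?_ ih)
      calc ‖x (k + m + 1) - x (k + m)‖₊ ≤ C * θ ^ (k + m) := hx (k + m)
        _ ≤ C * θ ^ k :=
            mul_le_mul' le_rfl (pow_le_pow_right_of_le_one' hθ.le (Nat.le_add_right k m))
  have hcs : CauchySeq x := by
    refine cauchySeq_of_le_geometric (θ : ℝ) C (by exact_mod_cast hθ) fun n ↦ ?_
    rw [dist_eq_norm, ← norm_neg, neg_sub]
    have h := hx n
    rw [← NNReal.coe_le_coe] at h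
    push_cast at h
    exact h
  obtain ⟨y, hy⟩ := cauchySeq_tendsto_of_complete hcs
  refine ⟨y, fun k ↦ ?_⟩
  have hlim : Tendsto (fun m ↦ x (k + m)) atTop (𝓝 y) := by
    have h1 : Tendsto (fun m : ℕ ↦ k + m) atTop atTop := by
      simpa only [add_comm] using tendsto_add_atTop_nat k
    exact hy.comp h1
  have hcont : Continuous fun a : F ↦ ‖a - x k‖₊ := by fun_prop
  have h := (hcont.tendsto y).comp hlim
  exact le_of_tendsto' h (fun m ↦ htail k m)

/-- **`z : E₁(F) → 𝔪` is onto** (Silverman, *AEC*, Prop. VII.2.2: `E₁(K) ≅ Ê(𝓜)` for complete `K`):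
for a Weierstrass equation `W` over `𝒪[F]` with `W ⊗ F` elliptic and `w a < 1` there is `P ∈ E₁(F)`
with `z(P) = a` — Hensel's lemma in `𝒪[F]` on the monic cubic of `FormalGroupChart.approxRoot`
(the tree's `LocalPoints.exists_mem_kernel_zCoord_eq` verbatim for an abstract `F`). This is the
hypothesis `hlift` of `FormalGroupChart.map_nsmul_kernelLevel_eq`.
[cite: SilvermanAEC2009, Prop. VII.2.2] -/
theorem exists_mem_kernel_zCoord_eq (W : WeierstrassCurve 𝒪[F]) [hE : (W.baseChange F).IsElliptic]
    [hV : (W.baseChange F).IsIntegral w.integer] {a : F} (ha : w a < 1) :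
    ∃ P ∈ kernel w (W.baseChange F), P.zCoord = a := by
  haveI : HenselianLocalRing 𝒪[F] := henselianLocalRing_integer'
  by_cases ha0 : a = 0
  · exact ⟨0, (kernel w (W.baseChange F)).zero_mem,
      by rw [WeierstrassCurve.Affine.Point.zCoord_zero, ha0]⟩
  have ha0' : 0 < w a := (Valuation.pos_iff _).mpr ha0
  have ha1 : w a ≤ 1 := ha.le
  have hamem : a ∈ 𝒪[F] := (w_le_one_iff hw a).mp ha1
  set a₀ : 𝒪[F] := ⟨a, hamem⟩ with ha₀def
  have ha₀ : (a₀ : F) = a := rfl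
  have ha₀m : a₀ ∈ 𝓂[F] := (w_coe_lt_one_iff hw a₀).mp ha
  set u₀ : 𝒪[F] := 1 - W.a₁ * a₀ - W.a₂ * a₀ ^ 2 with hu₀
  set c₀ : 𝒪[F] := (W.a₃ + W.a₄ * a₀) * a₀ ^ 3 with hc₀
  set d₀ : 𝒪[F] := W.a₆ * a₀ ^ 6 with hd₀
  have hc₀m : c₀ ∈ 𝓂[F] := by
    rw [hc₀, pow_succ, ← mul_assoc]
    exact Ideal.mul_mem_left _ _ ha₀m
  have hd₀m : d₀ ∈ 𝓂[F] := by
    rw [hd₀, pow_succ, ← mul_assoc]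
    exact Ideal.mul_mem_left _ _ ha₀m
  have hu₀1 : u₀ - 1 ∈ 𝓂[F] := by
    have e : u₀ - 1 = -(W.a₁ + W.a₂ * a₀) * a₀ := by rw [hu₀]; ring
    rw [e]
    exact Ideal.mul_mem_left _ _ ha₀m
  have hunit_of : ∀ x : 𝒪[F], x - 1 ∈ 𝓂[F] → IsUnit x := by
    intro x hx
    by_contra hxu
    have hxm : x ∈ 𝓂[F] := (IsLocalRing.mem_maximalIdeal _).mpr hxu
    have h1 : (1 : 𝒪[F]) ∈ 𝓂[F] := by
      have e : (1 : 𝒪[F]) = x - (x - 1) := by ring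
      rw [e]; exact Ideal.sub_mem _ hxm hx
    exact (IsLocalRing.maximalIdeal.isMaximal 𝒪[F]).ne_top ((Ideal.eq_top_iff_one _).mpr h1)
  have hu₀unit : IsUnit u₀ := hunit_of u₀ hu₀1
  set f : (𝒪[F])[X] := X ^ 3 + C u₀ * X ^ 2 + C c₀ * X - C d₀ with hf
  have hfmonic : f.Monic := by
    rw [hf, sub_eq_add_neg, add_assoc, add_assoc]
    refine (monic_X_pow 3).add_of_left ?_
    refine (degree_add_le _ _).trans_lt (max_lt ?_ ((degree_add_le _ _).trans_lt (max_lt ?_ ?_)))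
    · exact (degree_C_mul_X_pow_le 2 _).trans_lt (by rw [degree_X_pow]; norm_num)
    · exact (degree_C_mul_X_le _).trans_lt (by rw [degree_X_pow]; norm_num)
    · rw [degree_neg]; exact (degree_C_le).trans_lt (by rw [degree_X_pow]; norm_num)
  have hfeval : ∀ Y : 𝒪[F], f.eval Y = Y ^ 3 + u₀ * Y ^ 2 + c₀ * Y - d₀ := by
    intro Y
    rw [hf]
    simp only [eval_add, eval_sub, eval_mul, eval_pow, eval_X, eval_C]
  have hfder : ∀ Y : 𝒪[F], f.derivative.eval Y = 3 * Y ^ 2 + u₀ * (2 * Y) + c₀ := by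
    intro Y
    rw [hf]
    simp only [derivative_add, derivative_sub, derivative_mul, derivative_X_pow, derivative_C,
      derivative_X, zero_mul, zero_add, mul_one, sub_zero, eval_add, eval_mul, eval_pow, eval_X,
      eval_C]
    push_cast
    ring
  have h₁ : f.eval (-u₀) ∈ 𝓂[F] := by
    rw [hfeval]
    have e : (-u₀) ^ 3 + u₀ * (-u₀) ^ 2 + c₀ * (-u₀) - d₀ = -(c₀ * u₀ + d₀) := by ring
    rw [e]
    exact neg_mem (Ideal.add_mem _ (Ideal.mul_mem_right _ _ hc₀m) hd₀m)
  have h₂ : IsUnit (f.derivative.eval (-u₀)) := by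
    rw [hfder]
    refine hunit_of _ ?_
    have e : 3 * (-u₀) ^ 2 + u₀ * (2 * -u₀) + c₀ - 1 = (u₀ - 1) * (u₀ + 1) + c₀ := by ring
    rw [e]
    exact Ideal.add_mem _ (Ideal.mul_mem_right _ _ hu₀1) hc₀m
  obtain ⟨r, hr, hru⟩ := HenselianLocalRing.is_henselian f hfmonic (-u₀) h₁ h₂
  have hrunit : IsUnit r := by
    rw [← IsUnit.neg_iff]
    refine hunit_of (-r) ?_
    have e : -r - 1 = -(r - -u₀) + (u₀ - 1) := by ring
    rw [e]
    exact Ideal.add_mem _ (neg_mem hru) hu₀1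
  have hrv : w (r : F) = 1 := (w_coe_eq_one_iff hw r).mpr hrunit
  have ha3 : a ^ 3 ≠ 0 := pow_ne_zero 3 ha0
  set y : F := (r : F) / a ^ 3 with hy
  have hya : y * a ^ 3 = (r : F) := by rw [hy, div_mul_cancel₀ _ ha3]
  have hwy : w y * w a ^ 3 = 1 := by rw [← map_pow, ← map_mul, hya, hrv]
  have hy0 : y ≠ 0 := by
    intro h; rw [h, map_zero, zero_mul] at hwy; exact zero_ne_one hwy
  have hroot : (r : F) ^ 3 + ((u₀ : 𝒪[F]) : F) * (r : F) ^ 2 + ((c₀ : 𝒪[F]) : F) * r -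
      ((d₀ : 𝒪[F]) : F) = 0 := by
    have h : f.eval r = 0 := hr
    rw [hfeval] at h
    have h' := congrArg ((↑) : 𝒪[F] → F) h
    push_cast at h'
    exact h'
  have hu : ((u₀ : 𝒪[F]) : F) = 1 - (W.baseChange F).a₁ * a - (W.baseChange F).a₂ * a ^ 2 := by
    rw [hu₀]; push_cast; rw [ha₀]; rfl
  have hc : ((c₀ : 𝒪[F]) : F) =
      ((W.baseChange F).a₃ + (W.baseChange F).a₄ * a) * a ^ 3 := by
    rw [hc₀]; push_cast; rw [ha₀]; rfl
  have hd : ((d₀ : 𝒪[F]) : F) = (W.baseChange F).a₆ * a ^ 6 := by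
    rw [hd₀]; push_cast; rw [ha₀]; rfl
  rw [← hya, hu, hc, hd] at hroot
  have hg6 : a ^ 6 * (a ^ 3 * y ^ 3 + (1 - (W.baseChange F).a₁ * a - (W.baseChange F).a₂ * a ^ 2)
      * y ^ 2 + ((W.baseChange F).a₃ + (W.baseChange F).a₄ * a) * y - (W.baseChange F).a₆) = 0 := by
    rw [← monic_cubic_eval]
    linear_combination hroot
  have hg := (mul_eq_zero.mp hg6).resolve_left (pow_ne_zero 6 ha0)
  have heq : (W.baseChange F).toAffine.Equation (-a * y) y := equation_of_root hg
  have hns : (W.baseChange F).toAffine.Nonsingular (-a * y) y :=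
    WeierstrassCurve.Affine.equation_iff_nonsingular.mp heq
  refine ⟨.some (-a * y) y hns, some_mem_kernel hns (one_lt_val_of_root ha0' ha hwy), ?_⟩
  rw [WeierstrassCurve.Affine.Point.zCoord_some, neg_mul, neg_neg, mul_div_cancel_right₀ _ hy0]

/-- The chart kernel `FormalGroupChart.kernel w (W ⊗ F)` IS the kernel of reduction `E₁(F)` of
`ReductionHomomorphism.lean` (`P = O` or `x(P) ∉ 𝒪[F]`, i.e. `|x(P)| > 1`). [folklore] -/
private theorem mem_kernel_iff_reducesToZero (W : WeierstrassCurve 𝒪[F])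
    [hV : (W.baseChange F).IsIntegral w.integer] (P : (W.baseChange F).toAffine.Point) :
    P ∈ kernel w (W.baseChange F) ↔ W.ReducesToZero P := by
  rcases P with _ | ⟨x, y, h⟩
  · exact ⟨fun _ => WeierstrassCurve.reducesToZero_zero,
      fun _ => (kernel w (W.baseChange F)).zero_mem⟩
  · rw [some_mem_kernel_iff, WeierstrassCurve.reducesToZero_some_iff,
      not_mem_range_iff (Valuation.integer.integers (valuation F)), one_lt_w_iff hw]

end RealValuation

/-! ## §2 `E₁(F) ⊆ 2 E₁(F)` -/

/-- **The kernel of reduction is `2`-divisible in odd residue characteristic** (Kramer p. 125: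
"`E₁(F)` is uniquely divisible by `2`"; Silverman, *AEC* IV.2.3(b), IV.3.2, VII.2.2: `[m]` is an
automorphism of `Ê(𝓜)` for `m ∈ R^*`): for a Weierstrass equation `W` over `𝒪[F]` with `W ⊗ F`
elliptic, every `P ∈ E₁(F)` is `2 • Q` for some `Q ∈ E₁(F)`. Proof: `P` lies in the level
`U_ρ`, `ρ = |z(P)| < 1 = |2|`, of the chart filtration, and `2 • U_ρ = U_ρ` by the tree's
`FormalGroupChart.map_nsmul_kernelLevel_eq` (successive approximation in the complete field `F`,
with Hensel lifts `exists_mem_kernel_zCoord_eq`).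
[cite: Kramer1981, §2 proof of Prop. 3 (p. 125), "E₁(F) is uniquely divisible by 2"] -/
theorem exists_two_nsmul_eq_of_reducesToZero (hodd : ringChar 𝓀[F] ≠ 2) (W : WeierstrassCurve 𝒪[F])
    (hΔ : IsUnit W.Δ) {P : (W.baseChange F).toAffine.Point} (hP : W.ReducesToZero P) :
    ∃ Q : (W.baseChange F).toAffine.Point, W.ReducesToZero Q ∧ 2 • Q = P := by
  haveI : (W.baseChange F).IsElliptic :=
    ⟨by rw [WeierstrassCurve.baseChange, WeierstrassCurve.map_Δ]; exact hΔ.map _⟩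
  obtain ⟨w, hw⟩ := exists_valuation_eq_algNorm F
  haveI : (W.baseChange F).IsIntegral w.integer := isIntegral_baseChange hw W
  have hPk : P ∈ kernel w (W.baseChange F) := (mem_kernel_iff_reducesToZero hw W P).mpr hP
  set ρ : ℝ≥0 := w P.zCoord with hρ
  have hρ1 : ρ < 1 := val_zCoord_lt_one hPk
  have h2 : w ((2 : ℕ) : F) = 1 := by rw [Nat.cast_ofNat]; exact w_two hw hodd
  have hρ2 : ρ < w ((2 : ℕ) : F) := by rw [h2]; exact hρ1
  have hlift : ∀ a : F, w a ≤ ρ → ∃ P ∈ kernel w (W.baseChange F), P.zCoord = a :=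
    fun a ha => exists_mem_kernel_zCoord_eq hw W (ha.trans_lt hρ1)
  have hmap := map_nsmul_kernelLevel_eq (w := w) (V := W.baseChange F) (N := 2) hρ2 hlift
    (exists_limit_of_geometric hw)
  rw [h2, one_mul] at hmap
  have hPlevel : P ∈ kernelLevel w (W.baseChange F) ρ := ⟨hPk, le_rfl⟩
  rw [← hmap] at hPlevel
  obtain ⟨Q, hQ, hQP⟩ := hPlevel
  refine ⟨Q, (mem_kernel_iff_reducesToZero hw W Q).mp hQ.1, ?_⟩
  simpa using hQP

/-! ## §3 `[E(F) : 2E(F)] = #Ẽ(k)[2]` -/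

omit [ValuativeRel F] [TopologicalSpace F] [IsNonarchimedeanLocalField F] in
/-- The set of points of a Weierstrass cubic over a finite field is finite (it injects into
`Option (k × k)`; Silverman *AEC* V.§1). [folklore] -/
private theorem finite_point {k : Type*} [Field k] [Finite k] (V : WeierstrassCurve k) :
    Finite V.toAffine.Point := by
  refine Finite.of_injective (fun P : V.toAffine.Point ↦ match P with
    | .zero => (none : Option (k × k))
    | .some x y _ => some (x, y)) ?_
  rintro (_ | ⟨x, y, h⟩) (_ | ⟨x', y', h'⟩) hPQ
  · rfl
  · simp at hPQ
  · simp at hPQ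
  · simp only [Option.some.injEq, Prod.mk.injEq] at hPQ
    obtain ⟨rfl, rfl⟩ := hPQ
    rfl

omit [ValuativeRel F] [TopologicalSpace F] [IsNonarchimedeanLocalField F] in
/-- **`[A : nA] = #A[n]` for a finite abelian group** (the two ends of
`0 → A[n] → A →ⁿ A → A/nA → 0` have the same order; the case `U = 0` of the tree's Herbrand count
`LocalPoints.index_range_nsmul_eq`, Milne *ADT* I Lemma 3.3). [cite: MilneADT2006, I Lemma 3.3] -/
theorem index_range_nsmul_eq_card_torsionBy {A : Type*} [AddCommGroup A] [Finite A] (n : ℕ) :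
    (nsmulAddMonoidHom n : A →+ A).range.index = Nat.card (AddSubgroup.torsionBy A n) := by
  haveI : (⊥ : AddSubgroup A).FiniteIndex := by
    refine ⟨?_⟩
    rw [AddSubgroup.index_bot]
    exact Nat.card_pos.ne'
  have h := LocalPoints.index_range_nsmul_eq (G := A) ⊥ n
    (fun a ha _ => (AddSubgroup.mem_bot.mp ha))
  have hker : (nsmulAddMonoidHom n : A →+ A).ker = AddSubgroup.torsionBy A n := by
    ext x
    rw [AddMonoidHom.mem_ker, nsmulAddMonoidHom_apply, AddSubgroup.torsionBy.nsmul_iff]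
  rw [h, AddSubgroup.map_bot, AddSubgroup.relIndex_bot_left, AddSubgroup.card_bot, one_mul, hker]

/-- **`[E(F) : 2E(F)] = #Ẽ(k)[2]`** (Kramer p. 125: "`i(K/F) = dim E(k)/2E(k) = dim E(k)₂`", the
step `E(F)/2E(F) ≅ E(k)/2E(k)`): for a Weierstrass equation `W` over `𝒪[F]` with unit discriminant
over a local field `F` of odd residue characteristic, the index of `2E(F)` in `E(F) = (W ⊗ F)(F)`
equals the number of `2`-torsion points of the reduction `W̃(k)`. Proof: the reduction map
`E(F) → Ẽ(k)` (`goodReductionHom`, Silverman VII.2.1) is onto (Hensel, tree `exists_reducePoint_eq`)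
with kernel `E₁(F) ⊆ 2E(F)` (`exists_two_nsmul_eq_of_reducesToZero`), so it induces
`E(F)/2E(F) ≅ Ẽ(k)/2Ẽ(k)`, and `[Ẽ(k) : 2Ẽ(k)] = #Ẽ(k)[2]` for the finite group `Ẽ(k)`.
[cite: Kramer1981, §2 proof of Prop. 3 (p. 125), sequence (3): i(K/F) = dim E(k)/2E(k)] -/
theorem index_range_two_eq_card_torsionBy_two (hodd : ringChar 𝓀[F] ≠ 2)
    (W : WeierstrassCurve 𝒪[F]) (hΔ : IsUnit W.Δ) :
    (nsmulAddMonoidHom 2 : (W.baseChange F).toAffine.Point →+ _).range.index =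
      Nat.card
        (AddSubgroup.torsionBy (W.map (IsLocalRing.residue 𝒪[F])).toAffine.Point (2 : ℤ)) := by
  haveI : HenselianLocalRing 𝒪[F] := henselianLocalRing_integer'
  haveI : Finite (W.map (IsLocalRing.residue 𝒪[F])).toAffine.Point := finite_point _
  have hv : (valuation F).Integers 𝒪[F] := Valuation.integer.integers (valuation F)
  set red := goodReductionHom W hv hΔ with hred
  have hsurj : Function.Surjective red := fun Q => by
    obtain ⟨P, -, hP⟩ := W.exists_reducePoint_eq hv.hom_inj Q
    exact ⟨P, hP⟩
  set N₂ := (nsmulAddMonoidHom 2 : (W.map (IsLocalRing.residue 𝒪[F])).toAffine.Point →+ _).range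
    with hN₂
  set f := (QuotientAddGroup.mk' N₂).comp red with hf
  have hfs : Function.Surjective f := (QuotientAddGroup.mk'_surjective N₂).comp hsurj
  have hker : f.ker = (nsmulAddMonoidHom 2 : (W.baseChange F).toAffine.Point →+ _).range := by
    ext P
    rw [AddMonoidHom.mem_ker, hf, AddMonoidHom.comp_apply, QuotientAddGroup.mk'_apply,
      QuotientAddGroup.eq_zero_iff]
    constructor
    · rintro ⟨Rbar, hRbar⟩
      obtain ⟨R, hR⟩ := hsurj Rbar
      have h0 : red (P - 2 • R) = 0 := by
        rw [map_sub, map_nsmul, hR, ← hRbar, nsmulAddMonoidHom_apply, sub_self]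
      have hE1 : W.ReducesToZero (P - 2 • R) := (goodReductionHom_eq_zero_iff hv hΔ _).mp h0
      obtain ⟨Q, -, hQ⟩ := exists_two_nsmul_eq_of_reducesToZero hodd W hΔ hE1
      refine ⟨Q + R, ?_⟩
      rw [nsmulAddMonoidHom_apply, nsmul_add, hQ, sub_add_cancel]
    · rintro ⟨Q, rfl⟩
      refine ⟨red Q, ?_⟩
      rw [nsmulAddMonoidHom_apply, nsmulAddMonoidHom_apply, map_nsmul]
  have e := QuotientAddGroup.quotientKerEquivOfSurjective f hfs
  rw [← hker, AddSubgroup.index_eq_card, Nat.card_congr e.toEquiv, ← AddSubgroup.index_eq_card,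
    hN₂, index_range_nsmul_eq_card_torsionBy]
  norm_num

end Literature.NumberTheory.EllipticCurves.Kramer1981

end
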